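import Literature.MathematicalPhysics.QuantumFieldTheory.Balaban1983to89.B6RandomWalkInputNorm
import Literature.MathematicalPhysics.QuantumFieldTheory.Balaban1983to89.B6Prop26ReachTransplant

/-!
# `Balaban1983to89.B6RandomWalkInputNormTransplant` — T. Bałaban, *Propagators and renormalization transformations for lattice gauge theories. II*,
# Commun. Math. Phys. **96** (1984) 223–250 [Balaban1984PropagatorsII], (2.133)/(2.138) p. 247 with p. 238 (*"We take the cube □̃³ and identify it with a
# torus, denoted by T_□"*): TRANSPORT OF AN ADMISSIBLE-INPUT MAJORANT THROUGH A WINDOW CHART — the `HasMajorantA` twin of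
# `…B6Prop26ReachTransplant.localMajorant_transplant` / `…B6InMajorantTransplant.inMajorant_transplant` (file 3 of the `…B6RandomWalkInputNorm` layer)

statement-level skeleton of published theorems with citation tags; proofs where landed; nothing here is a claim about the Yang–Mills mass gap

PDF held: `paper:balaban1984-cmp96-propagators-rt-ii` (journal page = PDF page + 222); p. 238 [PDF 16] (T_□), p. 247 [PDF 25] ((2.133), (2.138)) as quoted in
`…B6Prop26ReachTransplant` / `…B6RandomWalkInputNorm`.

CITATION HEADER (lean-in-tree rule) — WHAT IS REPRODUCED.  Phase-2 file of the `lit-balaban` typed skeleton (HOME `run/shared/lean/pub/lit-balaban/`), seat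
**p27 gen 90** (TAKING HOME/STATUS 2026-08-24T22:31Z on p38 g34's named offer; B6 fold owner r03); SKELETON rows B6.Eq2.138 × B6.Eq2.133 × B6.Prop2.6 (cells
only; decls of record untouched).  The members of Prop. 2.5 live on their own tori `T_□` (p. 238) and are read on the global lattice through the window
chart (`…B6Prop26ReachTransplant.transplant W e T′ = ε ∘ T′ ∘ ρ`).  For sup inputs the tree transports block majorants through the chart by decomposing
the pulled-back input into LOCAL block pieces (`inMajorant_transplant`, fibre count `n`).  For an admissible input class (the Hölder data of (2.138)) no
such decomposition is available; instead the WHOLE pulled-back input `ρμ` must be admissible on the local lattice — a CLASS-TRANSPORT hypothesis — and the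
bound is read off at once:
* §1 **`hasMajorantA_transplant`** — if `T′ ≺_{adm′} K′` on the local lattice (blocks `blk′`), every `adm`-input `μ` at `y′` of size `B` pulls back to an
  `adm′`-input `ρμ` at the charted site `ch y′` of size `κ(y′)·B`, and `K′(blk′(e x), ch y′)·κ(y′) ≤ K(blk x, y′)` for window points `x`, then
  `transplant W e T′ ≺_{adm} K` (zero off the window); `hasMajorantA_transplant_ind` — the same with the input indicator `1_{S′}(y′)` when only inputs
  at sites of `S′` are transported;
* §2 **`normSupp_restrictOp`** — the class-transport hypothesis for the concrete class `NormSupp`: it holds as soon as the pull-back `ρ` carries the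
  support region of `y′` into that of `ch y′` and is bounded between the two size functionals (`N′(ch y′)(ρμ) ≤ κ(y′)·N(y′)(μ)`, `κ ≥ 0`) — the two
  geometric facts a k-level instance proves about its window chart (support: fibres of the chart; size: the chart preserves the pair distances of the
  Hölder quotient up to the level shift inside the window).
THEOREMS ONLY; no `def`, no `def … : Prop` fact; standard axioms.  Imports `…B6RandomWalkInputNorm` (p382304 ✓) and `…B6Prop26ReachTransplant`.

HONEST SCOPE.  Bookkeeping only; the k-level instance (the member (1.112) of [Balaban1984PropagatorsI] on `T_□`, the window charts of `…B6CubeWindowV1`,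
the comparison of the census Hölder functional with the member's) is NOT here.  NOT summit progress.  Unit `lit-balaban-p27` (gen 90), 2026-08-24.
-/

noncomputable section

open scoped BigOperators
open Finset

namespace Literature.MathematicalPhysics.QuantumFieldTheory.Balaban1983to89.B6RandomWalkInputNormTransplant

open B6Prop26Gluing (ind ind_nonneg ind_of_mem ind_of_not_mem)
open B6Prop26ReachTransplant (restrictOp transplant transplant_apply)
open B6RandomWalkInputNorm (HasMajorantA NormSupp)

variable {g g' : B6.Geometry} {X X' : Type} [DecidableEq X'] [DecidableEq X] {W : Finset X} {e : X → X'}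

/-! ## §1  Transport of an admissible-input majorant through the chart -/

/-- **TRANSPORT OF AN ADMISSIBLE-INPUT MAJORANT THROUGH THE WINDOW CHART**: `T′ ≺_{adm′} K′` on the local lattice, the class-transport hypothesis
`adm μ y′ B ⟹ adm′ (ρμ) (ch y′) (κ(y′)·B)` and the kernel comparison `K′(blk′(e x), ch y′)·κ(y′) ≤ K(blk x, y′)` on the window give
`transplant W e T′ ≺_{adm} K` (`K ≥ 0`; the transplanted operator vanishes off the window).
[cite: Balaban1984PropagatorsII, (2.133) p.247 + p.238 (T_□); derivation ours] -/
theorem hasMajorantA_transplant (blk : X → g.Site) (blk' : X' → g'.Site)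
    {adm : (X → ℝ) → g.Site → ℝ → Prop} {adm' : (X' → ℝ) → g'.Site → ℝ → Prop} (ch : g.Site → g'.Site) (κ : g.Site → ℝ)
    {T' : Module.End ℝ (X' → ℝ)} {K' : g'.Site → g'.Site → ℝ} (hT' : HasMajorantA blk' adm' T' K')
    (K : g.Site → g.Site → ℝ) (hK : ∀ a b, 0 ≤ K a b)
    (hadm : ∀ (μ : X → ℝ) (y' : g.Site) (B : ℝ), adm μ y' B → 0 ≤ B)
    (hclass : ∀ (μ : X → ℝ) (y' : g.Site) (B : ℝ), adm μ y' B → adm' (restrictOp W e μ) (ch y') (κ y' * B))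
    (hcomp : ∀ x ∈ W, ∀ y' : g.Site, K' (blk' (e x)) (ch y') * κ y' ≤ K (blk x) y') :
    HasMajorantA blk adm (transplant W e T') K := by
  intro y' μ B hμ x
  have hB : 0 ≤ B := hadm μ y' B hμ
  rw [transplant_apply]
  by_cases hxW : x ∈ W
  · rw [if_pos hxW]
    calc |T' (restrictOp W e μ) (e x)| ≤ K' (blk' (e x)) (ch y') * (κ y' * B) :=
          hT' (ch y') (restrictOp W e μ) (κ y' * B) (hclass μ y' B hμ) (e x)
      _ = (K' (blk' (e x)) (ch y') * κ y') * B := by ring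
      _ ≤ K (blk x) y' * B := mul_le_mul_of_nonneg_right (hcomp x hxW y') hB
  · rw [if_neg hxW, abs_zero]
    exact mul_nonneg (hK _ _) hB

/-- The same when only the admissible inputs at sites of a set `S′` are transported (the class-transport and the kernel comparison asked for
`y′ ∈ S′` only) and the operator kills the admissible inputs at the other sites: majorant `1_{S′}(y′)·K(y,y′)`.
[cite: Balaban1984PropagatorsII, (2.133) p.247 («y, y′ ∈ 𝔅 ∩ T_□») + p.238; derivation ours] -/
theorem hasMajorantA_transplant_ind (blk : X → g.Site) (blk' : X' → g'.Site)
    {adm : (X → ℝ) → g.Site → ℝ → Prop} {adm' : (X' → ℝ) → g'.Site → ℝ → Prop} (ch : g.Site → g'.Site) (κ : g.Site → ℝ)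
    (S' : Set g.Site) {T' : Module.End ℝ (X' → ℝ)} {K' : g'.Site → g'.Site → ℝ} (hT' : HasMajorantA blk' adm' T' K')
    (K : g.Site → g.Site → ℝ) (hK : ∀ a b, 0 ≤ K a b)
    (hadm : ∀ (μ : X → ℝ) (y' : g.Site) (B : ℝ), adm μ y' B → 0 ≤ B)
    (hclass : ∀ (μ : X → ℝ) (y' : g.Site) (B : ℝ), y' ∈ S' → adm μ y' B → adm' (restrictOp W e μ) (ch y') (κ y' * B))
    (hcomp : ∀ x ∈ W, ∀ y' ∈ S', K' (blk' (e x)) (ch y') * κ y' ≤ K (blk x) y')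
    (hkill : ∀ (μ : X → ℝ) (y' : g.Site) (B : ℝ), adm μ y' B → y' ∉ S' → transplant W e T' μ = 0) :
    HasMajorantA blk adm (transplant W e T') (fun a b => ind S' b * K a b) := by
  intro y' μ B hμ x
  have hB : 0 ≤ B := hadm μ y' B hμ
  beta_reduce
  by_cases hy : y' ∈ S'
  · rw [ind_of_mem hy, one_mul, transplant_apply]
    by_cases hxW : x ∈ W
    · rw [if_pos hxW]
      calc |T' (restrictOp W e μ) (e x)| ≤ K' (blk' (e x)) (ch y') * (κ y' * B) :=
            hT' (ch y') (restrictOp W e μ) (κ y' * B) (hclass μ y' B hy hμ) (e x)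
        _ = (K' (blk' (e x)) (ch y') * κ y') * B := by ring
        _ ≤ K (blk x) y' * B := mul_le_mul_of_nonneg_right (hcomp x hxW y' hy) hB
    · rw [if_neg hxW, abs_zero]
      exact mul_nonneg (hK _ _) hB
  · rw [hkill μ y' B hμ hy, Pi.zero_apply, abs_zero, ind_of_not_mem hy, zero_mul, zero_mul]

/-! ## §2  The class-transport hypothesis for `NormSupp` -/

omit [DecidableEq X] in
/-- **CLASS TRANSPORT FOR `NormSupp`**: if the pull-back `ρ` carries inputs supported over the region `R y′` to functions supported over the local
region `R′ (ch y′)`, and the local size functional of the pull-back is at most `κ(y′)` times the global one (`κ ≥ 0`), then `NormSupp`-inputs at `y′`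
of size `B` pull back to `NormSupp`-inputs at `ch y′` of size `κ(y′)·B` — the hypothesis `hclass` of `hasMajorantA_transplant` for the input Hölder data
of (2.138). [cite: Balaban1984PropagatorsII, (2.138) p.247 + p.238 (T_□); derivation ours] -/
theorem normSupp_restrictOp (blk : X → g.Site) (blk' : X' → g'.Site) {R : g.Site → Set g.Site} {R' : g'.Site → Set g'.Site}
    {N : g.Site → (X → ℝ) → ℝ} {N' : g'.Site → (X' → ℝ) → ℝ} (ch : g.Site → g'.Site) {κ : g.Site → ℝ} (hκ : ∀ y', 0 ≤ κ y')
    (hsupp : ∀ (μ : X → ℝ) (y' : g.Site), (∀ x, blk x ∉ R y' → μ x = 0) →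
      ∀ x', blk' x' ∉ R' (ch y') → restrictOp W e μ x' = 0)
    (hsize : ∀ (μ : X → ℝ) (y' : g.Site), (∀ x, blk x ∉ R y' → μ x = 0) → N' (ch y') (restrictOp W e μ) ≤ κ y' * N y' μ)
    {μ : X → ℝ} {y' : g.Site} {B : ℝ} (h : NormSupp blk R N μ y' B) :
    NormSupp blk' R' N' (restrictOp W e μ) (ch y') (κ y' * B) :=
  ⟨mul_nonneg (hκ y') h.nonneg, (hsize μ y' h.off).trans (mul_le_mul_of_nonneg_left h.bound (hκ y')), hsupp μ y' h.off⟩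

/-- … hence a `NormSupp`-majorant on the local lattice transplants to a `NormSupp`-majorant on the global lattice under the two geometric facts of
`normSupp_restrictOp` and the kernel comparison. [cite: Balaban1984PropagatorsII, (2.133)/(2.138) p.247 + p.238; derivation ours] -/
theorem hasMajorantA_normSupp_transplant (blk : X → g.Site) (blk' : X' → g'.Site) {R : g.Site → Set g.Site} {R' : g'.Site → Set g'.Site}
    {N : g.Site → (X → ℝ) → ℝ} {N' : g'.Site → (X' → ℝ) → ℝ} (ch : g.Site → g'.Site) {κ : g.Site → ℝ} (hκ : ∀ y', 0 ≤ κ y')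
    (hsupp : ∀ (μ : X → ℝ) (y' : g.Site), (∀ x, blk x ∉ R y' → μ x = 0) →
      ∀ x', blk' x' ∉ R' (ch y') → restrictOp W e μ x' = 0)
    (hsize : ∀ (μ : X → ℝ) (y' : g.Site), (∀ x, blk x ∉ R y' → μ x = 0) → N' (ch y') (restrictOp W e μ) ≤ κ y' * N y' μ)
    {T' : Module.End ℝ (X' → ℝ)} {K' : g'.Site → g'.Site → ℝ} (hT' : HasMajorantA blk' (NormSupp blk' R' N') T' K')
    (K : g.Site → g.Site → ℝ) (hK : ∀ a b, 0 ≤ K a b)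
    (hcomp : ∀ x ∈ W, ∀ y' : g.Site, K' (blk' (e x)) (ch y') * κ y' ≤ K (blk x) y') :
    HasMajorantA blk (NormSupp blk R N) (transplant W e T') K :=
  hasMajorantA_transplant blk blk' ch κ hT' K hK (fun _ _ _ h => h.nonneg)
    (fun _ _ _ h => normSupp_restrictOp blk blk' ch hκ hsupp hsize h) hcomp

end Literature.MathematicalPhysics.QuantumFieldTheory.Balaban1983to89.B6RandomWalkInputNormTransplant

end
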